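import Literature.ModelTheory.Zilber.EACAperiodicBase
import HarnessLib

/-!
# Periodicity of quadric graph bases (`x_{s+1} = Σ Mᵢⱼ xᵢ xⱼ + Σ bᵢ xᵢ + c`)

Literature support for the Zilber EAC case ladder (host summit: Schanuel), seat 1 gen 6, companion
to `EACAperiodicBase`: there `hasIntegerPeriod_graphBase_iff` characterises the integer periods of a
graph hypersurface `B_g = {x_{s+1} = g(x′)}` by the polynomial identity `g(X′ + w′) = g(X′) + w_{s+1}`,
and `hasIntegerPeriod_graphBase_linear_iff` reads it off for hyperplanes. Here we read it off for
QUADRICS, the bases of seat 2's largest families (`ZilberEacComplexQuadricEscape`,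
`ZilberEacComplexQuadricEscapeMatrix`, the Mantova–Masser model base `x₃ = x₁² - x₂²`
[Mantova–Masser 2024, §1 p. 5], the mismatch paraboloid):

* `hasIntegerPeriod_graphBase_iff_eval` — point form of the graph-base criterion:
  periodic iff `∃ w ∈ ℤ^{s+1} ∖ 0, ∀ x, g(x + w′) = g(x) + w_{s+1}`;
* `hasIntegerPeriod_graphBase_quadPoly_iff` — for `g = Σᵢⱼ Mᵢⱼ XᵢXⱼ + Σ bᵢXᵢ + c` over a field of
  characteristic `0`: periodic iff `∃ w ∈ ℤ^{s+1} ∖ 0` with `(M + Mᵀ) w′ = 0` and `Σ bᵢ wᵢ = w_{s+1}`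
  (so `w′` is a nonzero RATIONAL kernel vector of the symmetrised matrix and the linear part takes an
  integer value on it);
* `hasIntegerPeriod_graphBase_quadPoly_int_iff` — for INTEGER `M, b`: periodic iff `det (M + Mᵀ) = 0`;
* `hasIntegerPeriod_graphBase_diagQuadric_iff` — seat 2's diagonal shape `Σ aᵢXᵢ² + Σ bᵢXᵢ + c`
  verbatim: periodic iff `∃ w ≠ 0, (∀ i, aᵢ wᵢ = 0) ∧ Σ bᵢ wᵢ = w_{s+1}`; hence
  `not_hasIntegerPeriod_graphBase_diagQuadric` (all `aᵢ ≠ 0` ⇒ APERIODIC ⇒ rotundity and additive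
  freeness of every irreducible `(s+1)`-fold with this base closure are automatic, by
  `isRotund_of_not_hasIntegerPeriod`) and `hasIntegerPeriod_graphBase_diagQuadric_of_eq_zero`
  (some `aₖ = 0` with `bₖ ∈ ℤ` ⇒ PERIODIC, period `eₖ + bₖ e_{s+1}`).

Nothing here is an open statement; all `[folklore]` computations. HONEST FRAMING: census tools for
the open rung `EC(3,2)` = `ECCell 3 2` (which sub-cell of `ecCell_three_two_iff` a given family
populates); not a case of EAC by itself; nothing here bears on Schanuel's conjecture.
-/

namespace Literature.ModelTheory.Zilber

open MvPolynomial
open Literature.NumberTheory.Transcendental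

universe u

variable {F : Type u} [Field F] {s : ℕ}

section PointForm

/-- **Point form of the graph-base criterion**: `B_g` has an integer period iff for some
`w ∈ ℤ^{s+1} ∖ 0`, `g(x + w′) = g(x) + w_{s+1}` for every point `x` (over an infinite field a
polynomial identity is an identity of functions). [folklore] -/
theorem hasIntegerPeriod_graphBase_iff_eval [Infinite F] (g : MvPolynomial (Fin s) F) :
    HasIntegerPeriod F (graphBase g) ↔ ∃ w : Fin (s + 1) → ℤ, w ≠ 0 ∧
      ∀ x : Fin s → F, eval (x + fun i => (w (Fin.castSucc i) : F)) g =
        eval x g + (w (Fin.last s) : F) := by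
  rw [hasIntegerPeriod_graphBase_iff]
  refine exists_congr fun w => and_congr_right fun _ => ?_
  constructor
  · intro h x
    have key := congrArg (eval x) h
    rwa [eval_transl, map_add, eval_C] at key
  · intro h
    apply MvPolynomial.funext
    intro x
    rw [eval_transl, map_add, eval_C]
    exact h x

end PointForm

section Quadric

/-- The quadric polynomial `Σᵢⱼ Mᵢⱼ XᵢXⱼ + Σᵢ bᵢXᵢ + c` (no symmetry imposed on `M`). [folklore] -/
noncomputable def quadPoly (M : Matrix (Fin s) (Fin s) F) (b : Fin s → F) (c : F) :
    MvPolynomial (Fin s) F :=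
  ∑ i, ∑ j, C (M i j) * X i * X j + ∑ i, C (b i) * X i + C c

/-- The quadric as a function. [folklore] -/
def quadFun (M : Matrix (Fin s) (Fin s) F) (b : Fin s → F) (c : F) (x : Fin s → F) : F :=
  ∑ i, ∑ j, M i j * x i * x j + ∑ i, b i * x i + c

/-- `eval x (quadPoly M b c) = quadFun M b c x`. [folklore] -/
@[simp] theorem eval_quadPoly (M : Matrix (Fin s) (Fin s) F) (b : Fin s → F) (c : F)
    (x : Fin s → F) : eval x (quadPoly M b c) = quadFun M b c x := by
  simp only [quadPoly, quadFun, map_add, map_sum, map_mul, eval_C, eval_X]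

/-- **Taylor expansion of a quadric**:
`q(x + w) = q(x) + Σᵢ xᵢ ((M + Mᵀ) w)ᵢ + (wᵀ M w + b·w)`. [folklore] -/
theorem quadFun_add (M : Matrix (Fin s) (Fin s) F) (b : Fin s → F) (c : F) (x w : Fin s → F) :
    quadFun M b c (x + w) = quadFun M b c x + ∑ i, x i * (∑ j, (M i j + M j i) * w j) +
      (∑ i, ∑ j, M i j * w i * w j + ∑ i, b i * w i) := by
  have h1 : ∑ i, ∑ j, M i j * (x + w) i * (x + w) j =
      ∑ i, ∑ j, M i j * x i * x j + ∑ i, ∑ j, M i j * x i * w j +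
        ∑ i, ∑ j, M i j * w i * x j + ∑ i, ∑ j, M i j * w i * w j := by
    simp only [Pi.add_apply, ← Finset.sum_add_distrib]
    exact Finset.sum_congr rfl fun i _ => Finset.sum_congr rfl fun j _ => by ring
  have h2 : ∑ i, ∑ j, M i j * w i * x j = ∑ i, x i * ∑ j, M j i * w j := by
    rw [Finset.sum_comm]
    refine Finset.sum_congr rfl fun i _ => ?_
    rw [Finset.mul_sum]
    exact Finset.sum_congr rfl fun j _ => by ring
  have h3 : ∑ i, ∑ j, M i j * x i * w j = ∑ i, x i * ∑ j, M i j * w j := by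
    refine Finset.sum_congr rfl fun i _ => ?_
    rw [Finset.mul_sum]
    exact Finset.sum_congr rfl fun j _ => by ring
  have h4 : ∑ i, x i * (∑ j, (M i j + M j i) * w j) =
      ∑ i, x i * ∑ j, M i j * w j + ∑ i, x i * ∑ j, M j i * w j := by
    rw [← Finset.sum_add_distrib]
    refine Finset.sum_congr rfl fun i _ => ?_
    rw [← mul_add, ← Finset.sum_add_distrib]
    congr 1
    exact Finset.sum_congr rfl fun j _ => by ring
  have h5 : ∑ i, b i * (x + w) i = ∑ i, b i * x i + ∑ i, b i * w i := by
    simp only [Pi.add_apply, mul_add, Finset.sum_add_distrib]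
  simp only [quadFun]
  rw [h1, h2, h3, h4, h5]
  ring

/-- `wᵀ (M + Mᵀ) w = 2 wᵀ M w`. [folklore] -/
theorem sum_mul_symm_apply_eq_two_mul (M : Matrix (Fin s) (Fin s) F) (w : Fin s → F) :
    ∑ i, w i * (∑ j, (M i j + M j i) * w j) = 2 * ∑ i, ∑ j, M i j * w i * w j := by
  have e1 : ∑ i, w i * (∑ j, (M i j + M j i) * w j) =
      ∑ i, ∑ j, M i j * w i * w j + ∑ i, ∑ j, M j i * w i * w j := by
    rw [← Finset.sum_add_distrib]
    refine Finset.sum_congr rfl fun i _ => ?_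
    rw [Finset.mul_sum, ← Finset.sum_add_distrib]
    exact Finset.sum_congr rfl fun j _ => by ring
  have e2 : ∑ i, ∑ j, M j i * w i * w j = ∑ i, ∑ j, M i j * w i * w j := by
    rw [Finset.sum_comm]
    exact Finset.sum_congr rfl fun i _ => Finset.sum_congr rfl fun j _ => by ring
  rw [e1, e2]
  ring

/-- Picking out one coordinate: `Σᵢ (eₖ)ᵢ κᵢ = κₖ`. [folklore] -/
theorem sum_single_one_mul (k : Fin s) (κ : Fin s → F) :
    ∑ i, (Pi.single k (1 : F) : Fin s → F) i * κ i = κ k := by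
  classical
  simp only [Pi.single_apply, ite_mul, one_mul, zero_mul, Finset.sum_ite_eq',
    Finset.mem_univ, if_true]

/-- **Quadric graph bases** (char `0`). `B = {x_{s+1} = Σᵢⱼ Mᵢⱼ xᵢxⱼ + Σ bᵢxᵢ + c}` has an
integer period iff there is `w ∈ ℤ^{s+1} ∖ 0` with `(M + Mᵀ) w′ = 0` and `Σ bᵢ wᵢ = w_{s+1}`:
the period directions are the nonzero RATIONAL kernel vectors `w′` of the symmetrised matrix on
which the linear part takes an integer value (note `w′ᵀ M w′ = ½ w′ᵀ(M + Mᵀ)w′ = 0` then). In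
particular a quadric with non-degenerate quadratic part is aperiodic; `x₃ = (x₁ - x₂)²` is periodic
(`w = (1, 1, 0)`); `x₃ = x₁² + √2·x₂` is aperiodic although `M + Mᵀ` is singular. [folklore] -/
theorem hasIntegerPeriod_graphBase_quadPoly_iff [CharZero F] (M : Matrix (Fin s) (Fin s) F)
    (b : Fin s → F) (c : F) :
    HasIntegerPeriod F (graphBase (quadPoly M b c)) ↔ ∃ w : Fin (s + 1) → ℤ, w ≠ 0 ∧
      (∀ i, ∑ j, (M i j + M j i) * (w (Fin.castSucc j) : F) = 0) ∧
      ∑ i, b i * (w (Fin.castSucc i) : F) = (w (Fin.last s) : F) := by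
  classical
  haveI : Infinite F := Infinite.of_injective _ Nat.cast_injective
  rw [hasIntegerPeriod_graphBase_iff_eval]
  refine exists_congr fun w => and_congr_right fun _ => ?_
  simp only [eval_quadPoly, quadFun_add]
  -- abbreviations (definitional)
  have step : (∀ x : Fin s → F, quadFun M b c x +
        ∑ i, x i * (∑ j, (M i j + M j i) * (w (Fin.castSucc j) : F)) +
        (∑ i, ∑ j, M i j * (w (Fin.castSucc i) : F) * (w (Fin.castSucc j) : F) +
          ∑ i, b i * (w (Fin.castSucc i) : F)) =
        quadFun M b c x + (w (Fin.last s) : F)) ↔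
      ∀ x : Fin s → F, ∑ i, x i * (∑ j, (M i j + M j i) * (w (Fin.castSucc j) : F)) +
        (∑ i, ∑ j, M i j * (w (Fin.castSucc i) : F) * (w (Fin.castSucc j) : F) +
          ∑ i, b i * (w (Fin.castSucc i) : F)) = (w (Fin.last s) : F) :=
    forall_congr' fun x => by rw [add_assoc, add_right_inj]
  rw [step]
  have hQ : (∀ i, ∑ j, (M i j + M j i) * (w (Fin.castSucc j) : F) = 0) →
      ∑ i, ∑ j, M i j * (w (Fin.castSucc i) : F) * (w (Fin.castSucc j) : F) = 0 := by
    intro hk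
    have h2 := sum_mul_symm_apply_eq_two_mul M (fun i => (w (Fin.castSucc i) : F))
    simp only [hk, mul_zero, Finset.sum_const_zero] at h2
    exact (mul_eq_zero.1 h2.symm).resolve_left two_ne_zero
  constructor
  · intro h
    have h0 := h 0
    simp only [Pi.zero_apply, zero_mul, Finset.sum_const_zero, zero_add] at h0
    have hk : ∀ i, ∑ j, (M i j + M j i) * (w (Fin.castSucc j) : F) = 0 := by
      intro k
      have h1 := h (Pi.single k 1)
      rw [sum_single_one_mul, h0] at h1
      -- h1 : κ k + w_last = w_last
      simpa using h1
    refine ⟨hk, ?_⟩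
    rw [hQ hk, zero_add] at h0
    exact h0
  · rintro ⟨hk, hL⟩ x
    simp only [hk, mul_zero, Finset.sum_const_zero, zero_add, hQ hk]
    exact hL

/-- **Integer quadrics**: for `M ∈ ℤ^{s×s}`, `b ∈ ℤˢ` (any constant `c`), the base
`x_{s+1} = Σ Mᵢⱼxᵢxⱼ + Σ bᵢxᵢ + c` has an integer period iff `det (M + Mᵀ) = 0` (a singular integer
matrix has a nonzero integer kernel vector `w′`, and `w_{s+1} := Σ bᵢ wᵢ ∈ ℤ`). E.g. the
Mantova–Masser base `x₁² - x₂²` (`det = -4`) and the mismatch paraboloid `-x₁² - x₂²` (`det = 4`)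
are aperiodic; `(x₁ - x₂)²` (`det = 0`) is periodic. [folklore] -/
theorem hasIntegerPeriod_graphBase_quadPoly_int_iff [CharZero F] (M : Matrix (Fin s) (Fin s) ℤ)
    (b : Fin s → ℤ) (c : F) :
    HasIntegerPeriod F (graphBase (quadPoly (M.map (Int.cast : ℤ → F)) (fun i => (b i : F)) c)) ↔
      (M + M.transpose).det = 0 := by
  classical
  rw [hasIntegerPeriod_graphBase_quadPoly_iff, ← Matrix.exists_mulVec_eq_zero_iff]
  constructor
  · rintro ⟨w, hw, hk, hL⟩
    refine ⟨fun j => w (Fin.castSucc j), ?_, ?_⟩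
    · intro h0
      apply hw
      have h0' : ∀ j, w (Fin.castSucc j) = 0 := fun j => congrFun h0 j
      have hl : w (Fin.last s) = 0 := by
        have : (w (Fin.last s) : F) = 0 := by
          rw [← hL]
          simp [h0']
        exact_mod_cast this
      funext i
      refine Fin.lastCases ?_ (fun j => ?_) i
      · exact hl
      · exact h0' j
    · funext i
      have hi := hk i
      simp only [Matrix.map_apply] at hi
      have hi' : (((∑ j, (M i j + M j i) * w (Fin.castSucc j) : ℤ)) : F) = 0 := by
        push_cast
        exact hi
      have hz : ∑ j, (M i j + M j i) * w (Fin.castSucc j) = 0 := by exact_mod_cast hi'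
      simpa [Matrix.mulVec, dotProduct, Matrix.add_apply, Matrix.transpose_apply] using hz
  · rintro ⟨v, hv, hMv⟩
    refine ⟨(Fin.snoc v (∑ i, b i * v i) : Fin (s + 1) → ℤ), ?_, ?_, ?_⟩
    · intro h0
      apply hv
      funext j
      have := congrFun h0 (Fin.castSucc j)
      simpa using this
    · intro i
      have hi := congrFun hMv i
      simp only [Matrix.mulVec, dotProduct, Matrix.add_apply, Matrix.transpose_apply,
        Pi.zero_apply] at hi
      have hi' := congrArg (Int.cast : ℤ → F) hi
      push_cast at hi'
      simpa only [Fin.snoc_castSucc, Matrix.map_apply] using hi'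
    · simp only [Fin.snoc_castSucc, Fin.snoc_last]
      push_cast
      rfl

end Quadric

section Diagonal

/-- **Diagonal quadrics, seat 2's shape verbatim** (`ZilberEacComplexQuadricEscape`:
`g = Σ aᵢXᵢ² + Σ bᵢXᵢ + c₀`). The base `x_{s+1} = g(x′)` has an integer period iff there is
`w ∈ ℤ^{s+1} ∖ 0` with `aᵢ wᵢ = 0` for all `i` (i.e. `w′` supported where `a` vanishes) and
`Σ bᵢ wᵢ = w_{s+1}`. The escape theorem's hypothesis `Σ aᵢ ≠ 0` does not decide this: e.g.
`a = (1, 0)`, `b = (0, ½)` is periodic (`w = (0, 2, 1)`), `a = (1, 0)`, `b = (0, √2)` is aperiodic.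
[folklore] -/
theorem hasIntegerPeriod_graphBase_diagQuadric_iff [CharZero F] (a b : Fin s → F) (c : F) :
    HasIntegerPeriod F (graphBase (∑ i, C (a i) * X i ^ 2 + ∑ i, C (b i) * X i + C c)) ↔
      ∃ w : Fin (s + 1) → ℤ, w ≠ 0 ∧ (∀ i, a i * (w (Fin.castSucc i) : F) = 0) ∧
        ∑ i, b i * (w (Fin.castSucc i) : F) = (w (Fin.last s) : F) := by
  classical
  have hq : (∑ i, C (a i) * X i ^ 2 + ∑ i, C (b i) * X i + C c : MvPolynomial (Fin s) F) =
      quadPoly (Matrix.diagonal a) b c := by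
    simp only [quadPoly, Matrix.diagonal_apply]
    congr 1
    congr 1
    refine Finset.sum_congr rfl fun i _ => ?_
    rw [Finset.sum_eq_single i]
    · rw [if_pos rfl]; ring
    · intro j _ hj
      rw [if_neg (Ne.symm hj), C_0, zero_mul, zero_mul]
    · intro hi
      exact absurd (Finset.mem_univ i) hi
  rw [hq, hasIntegerPeriod_graphBase_quadPoly_iff]
  refine exists_congr fun w => and_congr_right fun _ => and_congr_left fun _ => ?_
  refine forall_congr' fun i => ?_
  have hdiag : ∑ j, (Matrix.diagonal a i j + Matrix.diagonal a j i) * (w (Fin.castSucc j) : F) =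
      2 * (a i * (w (Fin.castSucc i) : F)) := by
    rw [Finset.sum_eq_single i]
    · simp only [Matrix.diagonal_apply_eq]; ring
    · intro j _ hj
      rw [Matrix.diagonal_apply_ne _ (Ne.symm hj), Matrix.diagonal_apply_ne _ hj, add_zero,
        zero_mul]
    · intro hi
      exact absurd (Finset.mem_univ i) hi
  rw [hdiag, mul_eq_zero, or_iff_right (two_ne_zero' F)]

/-- **Non-degenerate diagonal quadric bases are aperiodic**: if every `aᵢ ≠ 0` then
`x_{s+1} = Σ aᵢxᵢ² + Σ bᵢxᵢ + c` has no integer period — so (by `isRotund_of_not_hasIntegerPeriod`,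
`isAddFree_of_not_hasIntegerPeriod`) every irreducible `(s+1)`-fold of full dimension whose
additive projection has this closure is rotund and additively free FOR FREE, and its exponential
points are instances of the rotundity-free sub-cell `ECCellAperiodic s`. Covers the Mantova–Masser
base, the mismatch paraboloid and every non-degenerate instance of seat 2's Theorem E / escape
family. [folklore] -/
theorem not_hasIntegerPeriod_graphBase_diagQuadric [CharZero F] (a b : Fin s → F) (c : F)
    (ha : ∀ i, a i ≠ 0) :
    ¬ HasIntegerPeriod F (graphBase (∑ i, C (a i) * X i ^ 2 + ∑ i, C (b i) * X i + C c)) := by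
  rw [hasIntegerPeriod_graphBase_diagQuadric_iff]
  rintro ⟨w, hw, hk, hL⟩
  have h0 : ∀ i, w (Fin.castSucc i) = 0 := fun i => by
    have := (mul_eq_zero.1 (hk i)).resolve_left (ha i)
    exact_mod_cast this
  have hl : w (Fin.last s) = 0 := by
    have : (w (Fin.last s) : F) = 0 := by rw [← hL]; simp [h0]
    exact_mod_cast this
  apply hw
  funext i
  exact Fin.lastCases hl (fun j => h0 j) i

/-- **Degenerate diagonal quadric bases with an integer linear coefficient are periodic**: if
`aₖ = 0` and `bₖ = m ∈ ℤ`, then `eₖ + m·e_{s+1}` is a period of `x_{s+1} = Σ aᵢxᵢ² + Σ bᵢxᵢ + c`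
— such members of seat 2's escape family (allowed by its hypothesis `Σ aᵢ ≠ 0` as soon as
`s ≥ 2`) populate the PERIODIC sub-cell `ECCellPeriodic s`, where rotundity is a genuine
hypothesis. [folklore] -/
theorem hasIntegerPeriod_graphBase_diagQuadric_of_eq_zero [CharZero F] (a b : Fin s → F) (c : F)
    (k : Fin s) (hk : a k = 0) (m : ℤ) (hm : b k = (m : F)) :
    HasIntegerPeriod F (graphBase (∑ i, C (a i) * X i ^ 2 + ∑ i, C (b i) * X i + C c)) := by
  classical
  rw [hasIntegerPeriod_graphBase_diagQuadric_iff]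
  refine ⟨(Fin.snoc (Pi.single k 1) m : Fin (s + 1) → ℤ), ?_, ?_, ?_⟩
  · intro h0
    have := congrFun h0 (Fin.castSucc k)
    simp at this
  · intro i
    simp only [Fin.snoc_castSucc, Pi.single_apply]
    split_ifs with hi
    · subst hi; simp [hk]
    · simp
  · simp only [Fin.snoc_castSucc, Fin.snoc_last, Pi.single_apply, Int.cast_ite, Int.cast_one,
      Int.cast_zero, mul_ite, mul_one, mul_zero, Finset.sum_ite_eq', Finset.mem_univ, if_true]
    exact hm

end Diagonal

end Literature.ModelTheory.Zilber
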